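import Literature.Analysis.ODE.ElementaryFieldDoubletonStepFast
import HarnessLib

/-!
# Doubleton (QR–Lohner) chains for elementary fields — the fast checker

Trunk T-ANA (Analysis/ODE); namespace `Literature.Analysis.ODE`.

`ElementaryFieldDoubletonChainCertificate.lean` decides a transcript of `C¹`-Lohner doubleton
hand-overs (`EDStage.stepCheck`, `EDChainCert.check`) and proves it sound
(`EDChainCert.sound`, `eDoubletonChainVerifier`).  Its cost in the kernel is dominated by the
Jacobian code lists `pderiv l (taylorExpr F j i)` of the `C¹` test.  This file (the fourth of
four: `CodeListSimplification.lean`, `ElementaryFieldVariationalCertificateFast.lean`,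
`ElementaryFieldDoubletonStepFast.lean`, this file) is the SAME chain with every hand-over decided
by the fast test `EDStage.stepCheckS` (constant-folded Jacobian code lists):

* `edChainCheckS`, `EDChainCert.checkS`, `check_stageS`, `soundS`, `mem_hullS`,
  `mem_finalHullS`, `mem_hull_of_boxS` — the chain, assembled from `EDStage.handoverS` by the
  generic gluing of `StepChain.lean` exactly as `EDChainCert.sound`;
* `eDoubletonChainVerifierS` — the sound verifier for elementary chain instances
  (`EChainInstance.Claim`: existence on `[0, T]` from every point of the box and `y(T) ∈ F`) that
  accepts the same certificate data `EDChainData` as `eDoubletonChainVerifier`;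
* the pendulum-from-a-box transcript `pendulumBoxDData` of the tree, re-decided by the fast checker
  (`pendulumBoxDS_claim`).

Honest framing.  A second decidable test on unchanged certificate structures with its own
soundness theorem; the two tests may disagree on acceptance (different code lists round
differently), each is sound.  Measured (farm `lean check`, 2026-08-27, the checker modules inlined
ahead of landing): the 39-stage swing-equation transcript of
`Literature.Computation.Certificates.CapOdeDoubletonReplayPostFaultData` (order 6, `n = 2`) is
re-decided stage by stage with `stepCheckS` in ONE file in 498 s wall (≈ 12 s per stage; the landed
nine-conjunct form of `CapOdeDoubletonReplayPostFaultStages01…20` costs ≈ 118 s per stage, one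
`decide` on `stepCheck` ≈ 55 s); a Lorenz transcript (`n = 3`, classic parameters, box of width
`2⁻¹⁵`, `T = 1/8`) costs ≈ 37 s per stage at order 6 (12 stages, 486 s) and ≈ 190 s per stage at
order 8 — the first order-8 `C¹` step this kernel bridge has reduced.

## References

* M. Mrozek, P. Zgliczyński, Ann. Polon. Math. 74 (2000), Theorem 7.5, §7.5 Lemma 7.6, §8 Lemmas
  8.1–8.5. [MrozekZgliczynski2000]
* T. Kapela, P. Zgliczyński, Discrete Contin. Dyn. Syst. B 11 (2009), §6.1, §6.4. [KapelaZgliczynski2009]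
* R. E. Moore, *Methods and Applications of Interval Analysis*, SIAM 1979, §3.4 (note after
  (3.19)), §8.1 eq. (8.13) and pp. 97–99, §8.2. [Moore1979]
-/

set_option autoImplicit false

open Set NonemptyInterval Matrix
open scoped Pointwise
open Literature.Analysis.ValidatedNumerics Literature.Analysis.ValidatedNumerics.ITaylor
open Literature.Analysis.ODE.FExpr

namespace Literature.Analysis.ODE

variable {n : ℕ}

/-! ### Doubleton chains, fast checker -/

section Chain

/-- The fast decidable chain test: every stage checks (fast) against the next node.
[cite: MrozekZgliczynski2000, Lemma 8.5] [cite: Moore1979, §8.1 eq. (8.13)] -/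
noncomputable def edChainCheckS (F : Fin n → FExpr n) (cfg : SeedCfg) (R0 : Fin n → Iv)
    (fin : DNode n) : List (EDStage n) → Bool
  | [] => true
  | s :: rest => s.stepCheckS F cfg R0 (edNext fin rest) && edChainCheckS F cfg R0 fin rest

namespace EDChainCert

variable (c : EDChainCert n)

/-- THE FAST DECIDABLE CHAIN TEST of a doubleton chain certificate.
[cite: MrozekZgliczynski2000, Lemma 8.5] [cite: Moore1979, §3.4 (note after eq. (3.19))] -/
noncomputable def checkS : Bool := edChainCheckS c.field c.cfg c.r0 c.final c.stages

variable {c}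

/-- Same steps `hⱼ` in the underlying transcript (definitional bookkeeping). [folklore] -/
private theorem toHOEChain_stepS (j : ℕ) :
    (c.toHOEChain.stageAt j).step = (c.stageAt j).step := by
  have h : c.toHOEChain.stageAt j = (c.stageAt j).toHOEStage := by
    show (c.stages.map EDStage.toHOEStage).getD j (EDStage.toHOEStage c.padStage) = _
    rw [List.getD_map]
    rfl
  rw [h]
  rfl

/-- The length of step `j` of the mesh is `hⱼ` (definitional bookkeeping). [folklore] -/
private theorem toHOEChain_mesh_stepS (j : ℕ) :
    c.toHOEChain.mesh (j + 1) - c.toHOEChain.mesh j = ((c.stageAt j).step : ℝ) := by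
  rw [HOEChainCert.mesh_step, toHOEChain_stepS]

/-- Node `j < N` is the node of stage `j` (bookkeeping). [folklore] -/
private theorem nodeAt_eqS {j : ℕ} (hj : j < c.size) : c.nodeAt j = (c.stageAt j).node := by
  rw [nodeAt, stageAt, List.getD_eq_getElem _ _ (by simpa [size] using hj),
    List.getD_eq_getElem _ _ hj, List.getElem_map]
  rfl

/-- Node `N` is the final node (bookkeeping). [folklore] -/
private theorem nodeAt_sizeS : c.nodeAt c.size = c.final := by
  rw [nodeAt, List.getD_eq_default _ _ (by simp [size])]

/-- Unfolding of the fast chain test, stage by stage. [cite: Moore1979, §8.1 eq. (8.13)]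
[cite: MrozekZgliczynski2000, Lemma 8.5] -/
theorem edChainCheckS_spec {F : Fin n → FExpr n} {cfg : SeedCfg} {R0 : Fin n → Iv}
    {fin : DNode n} {pad : EDStage n} :
    ∀ l : List (EDStage n), edChainCheckS F cfg R0 fin l = true → ∀ j < l.length,
      (l.getD j pad).stepCheckS F cfg R0 ((l.map EDStage.node).getD (j + 1) fin) = true
  | [], _, j, hj => absurd hj (Nat.not_lt_zero j)
  | s :: rest, h, j, hj => by
    simp only [edChainCheckS, Bool.and_eq_true] at h
    obtain ⟨h1, h2⟩ := h
    cases j with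
    | zero =>
      simp only [List.getD_cons_zero, List.map_cons, List.getD_cons_succ, zero_add]
      cases rest with
      | nil => simpa [edNext] using h1
      | cons s' rest' => simpa [edNext] using h1
    | succ j =>
      simp only [List.getD_cons_succ, List.map_cons]
      exact edChainCheckS_spec rest h2 j (by simpa using hj)

/-- Stage `j < N` checks (fast) against node `j + 1`. [cite: MrozekZgliczynski2000, Lemma 8.5] -/
theorem check_stageS (hc : c.checkS = true) {j : ℕ} (hj : j < c.size) :
    (c.stageAt j).stepCheckS c.field c.cfg c.r0 (c.nodeAt (j + 1)) = true :=
  edChainCheckS_spec c.stages hc j hj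

/-- **SOUNDNESS OF DOUBLETON CHAINS, FAST CHECKER.** If the chain checks (fast) then, for every
`r₀ ∈ [R⁰]` and every `y₀ ∈ 𝒟₀(r₀)`: a solution of `y' = f(y)`, `y(0) = y₀` exists on `[0, τ_N]`,
and EVERY such solution satisfies `y(τⱼ) ∈ 𝒟ⱼ(r₀)` for all `j ≤ N` and stays in `[Sⱼ]` on
`[τⱼ, τⱼ₊₁]` — the proof of `EDChainCert.sound` with `handoverS`.
[cite: MrozekZgliczynski2000, Lemma 8.5] [cite: MrozekZgliczynski2000, §7.5 Lemma 7.6]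
[cite: KapelaZgliczynski2009, §6.1 and §6.4 (Evaluation 4)] [cite: Moore1979, §8.1 eq. (8.13)] -/
theorem soundS (hc : c.checkS = true) {r₀ : Fin n → ℝ} (hr₀ : r₀ ∈ boxSet (castBox c.r0))
    {y₀ : Fin n → ℝ} (hy₀ : y₀ ∈ (c.nodeAt 0).dset r₀) :
    (∃ y : ℝ → Fin n → ℝ, y 0 = y₀ ∧
      ∀ t ∈ Icc (0 : ℝ) (c.toHOEChain.mesh c.size),
        HasDerivWithinAt y (fieldFun c.field (y t)) (Icc (0 : ℝ) (c.toHOEChain.mesh c.size)) t) ∧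
    ∀ y : ℝ → Fin n → ℝ, y 0 = y₀ →
      (∀ t ∈ Icc (0 : ℝ) (c.toHOEChain.mesh c.size),
        HasDerivWithinAt y (fieldFun c.field (y t)) (Icc (0 : ℝ) (c.toHOEChain.mesh c.size)) t) →
      (∀ j ≤ c.size, y (c.toHOEChain.mesh j) ∈ (c.nodeAt j).dset r₀) ∧
      ∀ j < c.size, ∀ t ∈ Icc (c.toHOEChain.mesh j) (c.toHOEChain.mesh (j + 1)),
        y t ∈ boxSet (castBox (c.stageAt j).apriori) := by
  set Q : ℕ → ℝ → (Fin n → ℝ) → (Fin n → ℝ) → Prop := fun j s _ w =>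
    w ∈ boxSet (castBox (c.stageAt j).apriori) ∧
      (s = ((c.stageAt j).step : ℝ) → w ∈ (c.nodeAt (j + 1)).dset r₀)
  set τ : ℕ → ℝ := c.toHOEChain.mesh
  have hτ0 : τ 0 = 0 := HOEChainCert.mesh_zero
  have hτs : ∀ j, τ (j + 1) - τ j = ((c.stageAt j).step : ℝ) := toHOEChain_mesh_stepS
  have hE : ∀ j < c.size, ((c.stageAt j).cert c.field c.cfg).toE.check = true := fun j hj =>
    (EVarStepCert.checkS_spec (EMVStepCert.checkS_spec
      (EDStage.stepCheckS_spec (check_stageS hc hj)).1).1).1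
  have hτ : ∀ j < c.size, τ j ≤ τ (j + 1) := fun j hj => by
    have h := hτs j
    have hh : (0 : ℝ) ≤ ((c.stageAt j).step : ℝ) := (EStepCert.check_spec (hE j hj)).2.1
    linarith
  have hall : ∀ j < c.size, ∀ x ∈ (c.nodeAt j).dset r₀, ∀ z : ℝ → Fin n → ℝ, z 0 = x →
      (∀ s ∈ Icc 0 (τ (j + 1) - τ j),
        HasDerivWithinAt z (fieldFun c.field (z s)) (Icc 0 (τ (j + 1) - τ j)) s) →
      ∀ s ∈ Icc 0 (τ (j + 1) - τ j), Q j s x (z s) := by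
    intro j hj x hx z hz0 hz s hs
    rw [hτs] at hz hs
    rw [nodeAt_eqS hj] at hx
    have hcj := check_stageS hc hj
    show z s ∈ boxSet (castBox (c.stageAt j).apriori) ∧
      (s = ((c.stageAt j).step : ℝ) → z s ∈ (c.nodeAt (j + 1)).dset r₀)
    refine ⟨((EStepCert.sound (hE j hj) (EDStage.mem_initS hcj hr₀ hx)).2 z hz0 hz s hs).1,
      fun hs' => ?_⟩
    rw [hs']
    exact EDStage.handoverS hcj hr₀ hx hz0 hz
  have hland : ∀ j < c.size, ∀ x ∈ (c.nodeAt j).dset r₀, ∀ w,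
      Q j (τ (j + 1) - τ j) x w → w ∈ (c.nodeAt (j + 1)).dset r₀ := by
    intro j _ x _ w hw
    obtain ⟨-, hw⟩ := hw
    exact hw (hτs j)
  refine ⟨?_, fun y hy0 hy => ?_⟩
  · have hstep : ∀ j < c.size, ∀ x ∈ (c.nodeAt j).dset r₀, ∃ z : ℝ → Fin n → ℝ, z 0 = x ∧
        (∀ s ∈ Icc 0 (τ (j + 1) - τ j),
          HasDerivWithinAt z (fieldFun c.field (z s)) (Icc 0 (τ (j + 1) - τ j)) s) ∧
        ∀ s ∈ Icc 0 (τ (j + 1) - τ j), Q j s x (z s) := by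
      intro j hj x hx
      have hcj := check_stageS hc hj
      have hx' := hx
      rw [nodeAt_eqS hj] at hx'
      obtain ⟨z, hz0, hz⟩ := EMVStepCert.exists_of_checkS (EDStage.stepCheckS_spec hcj).1
        (EDStage.mem_initS hcj hr₀ hx')
      refine ⟨z, hz0, ?_, ?_⟩
      · rw [hτs]; exact hz
      · exact hall j hj x hx z hz0 (by rw [hτs]; exact hz)
    obtain ⟨y, hy0, hy, -, -⟩ :=
      exists_solution_of_stepChain (f := fieldFun c.field)
        (W := fun j => (c.nodeAt j).dset r₀) (Q := Q) c.size hτ0 hτ hstep hland hy₀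
    exact ⟨y, hy0, hy⟩
  · have hyW : y 0 ∈ (c.nodeAt 0).dset r₀ := hy0 ▸ hy₀
    obtain ⟨hW, hQ'⟩ :=
      solution_mem_of_stepChain (f := fieldFun c.field)
        (W := fun j => (c.nodeAt j).dset r₀) (Q := Q) c.size hτ0 hτ hall hland hyW hy
    refine ⟨hW, fun j hj t ht => ?_⟩
    obtain ⟨h1, -⟩ := hQ' j hj t ht
    exact h1

/-- Corollary: `y(τⱼ)` lies in the interval hull of node `j` (fast checker).
[cite: MrozekZgliczynski2000, Lemma 8.1] [cite: Moore1979, §8.1 pp. 97–99 (the wrapping effect)] -/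
theorem mem_hullS (hc : c.checkS = true) {r₀ : Fin n → ℝ} (hr₀ : r₀ ∈ boxSet (castBox c.r0))
    {y₀ : Fin n → ℝ} (hy₀ : y₀ ∈ (c.nodeAt 0).dset r₀) {y : ℝ → Fin n → ℝ} (hy0 : y 0 = y₀)
    (hy : ∀ t ∈ Icc (0 : ℝ) (c.toHOEChain.mesh c.size),
      HasDerivWithinAt y (fieldFun c.field (y t)) (Icc (0 : ℝ) (c.toHOEChain.mesh c.size)) t)
    {j : ℕ} (hj : j ≤ c.size) :
    y (c.toHOEChain.mesh j) ∈ boxSet (castBox (c.hullAt j)) :=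
  DNode.dset_subset_dHull hr₀ (((soundS hc hr₀ hy₀).2 y hy0 hy).1 j hj)

/-- Corollary: `y(τ_N)` lies in the final hull (fast checker). [cite: MrozekZgliczynski2000, Lemma 8.1]
[cite: Moore1979, §8.1 pp. 97–99 (the wrapping effect)] -/
theorem mem_finalHullS (hc : c.checkS = true) {r₀ : Fin n → ℝ} (hr₀ : r₀ ∈ boxSet (castBox c.r0))
    {y₀ : Fin n → ℝ} (hy₀ : y₀ ∈ (c.nodeAt 0).dset r₀) {y : ℝ → Fin n → ℝ} (hy0 : y 0 = y₀)
    (hy : ∀ t ∈ Icc (0 : ℝ) (c.toHOEChain.mesh c.size),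
      HasDerivWithinAt y (fieldFun c.field (y t)) (Icc (0 : ℝ) (c.toHOEChain.mesh c.size)) t) :
    y (c.toHOEChain.mesh c.size) ∈ boxSet (castBox c.finalHull) := by
  have h := mem_hullS hc hr₀ hy₀ hy0 hy le_rfl
  rwa [hullAt, nodeAt_sizeS] at h

/-- **From a box of initial values** (fast checker): if `C₀ = 1`, `0 ∈ [R₀]` and `W − x₀ ⊆ [R⁰]`,
every solution from `y₀ ∈ W` on `[0, τ_N]` has `y(τⱼ) ∈ hull(𝒟ⱼ)` for `j ≤ N`.
[cite: KapelaZgliczynski2009, §6.1 and §6.4 (Evaluation 4)] [cite: MrozekZgliczynski2000, Lemma 8.1] -/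
theorem mem_hull_of_boxS (hc : c.checkS = true) (hC : isOneQ (c.nodeAt 0).cmat = true)
    (hR : boxLE (pointBox 0) (c.nodeAt 0).rem = true) {W : Fin n → Iv}
    (hW : boxLE (shiftBox W (c.nodeAt 0).center) c.r0 = true)
    {y : ℝ → Fin n → ℝ} (hy0 : y 0 ∈ boxSet (castBox W))
    (hy : ∀ t ∈ Icc (0 : ℝ) (c.toHOEChain.mesh c.size),
      HasDerivWithinAt y (fieldFun c.field (y t)) (Icc (0 : ℝ) (c.toHOEChain.mesh c.size)) t)
    {j : ℕ} (hj : j ≤ c.size) :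
    y (c.toHOEChain.mesh j) ∈ boxSet (castBox (c.hullAt j)) :=
  mem_hullS hc (boxSet_mono (castBox_mono (le_of_boxLE hW))
      (mem_boxSet_iff.2 fun l => sub_mem_shiftBox hy0 l))
    (DNode.start_mem hC hR (y 0)) rfl hy hj

end EDChainCert

end Chain

/-! ### Packaging: the fast doubleton chain verifier for elementary chain instances -/

section VerifierPackaging

/-- **The fast doubleton chain verifier for elementary chain instances** `(f, W₀, T, F)`: SOUND,
not complete; the same certificate data `EDChainData` and the same acceptance conditions as
`eDoubletonChainVerifier`, the chain decided by `EDChainCert.checkS`.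
[cite: MrozekZgliczynski2000, Lemma 8.5] [cite: KapelaZgliczynski2009, §6.1 and §6.4 (Evaluation 4)]
[cite: Moore1979, §3.4 (note after eq. (3.19))] -/
noncomputable def eDoubletonChainVerifierS (n : ℕ) :
    Verifier (EChainInstance n) EChainInstance.Claim where
  Cert := EDChainData n
  check I d :=
    isOneQ ((I.withEDStages d).nodeAt 0).cmat && boxLE (pointBox 0) ((I.withEDStages d).nodeAt 0).rem &&
      boxLE (shiftBox I.init ((I.withEDStages d).nodeAt 0).center) d.r0 &&
        decide ((I.withEDStages d).toHOEChain.meshQ d.stages.length = I.horizon) &&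
          (I.withEDStages d).checkS && boxLE (I.withEDStages d).finalHull I.final
  sound I d h := by
    simp only [Bool.and_eq_true, decide_eq_true_eq] at h
    obtain ⟨⟨⟨⟨⟨hC, hR⟩, h0⟩, hT⟩, hc⟩, hF⟩ := h
    have hT' : (I.horizon : ℝ) =
        (I.withEDStages d).toHOEChain.mesh (I.withEDStages d).size := by
      rw [← hT, HOEChainCert.cast_meshQ]
      rfl
    intro y₀ hy₀
    have hr₀ : y₀ - ((I.withEDStages d).nodeAt 0).centerVec ∈ boxSet (castBox (I.withEDStages d).r0) :=
      boxSet_mono (castBox_mono (le_of_boxLE h0)) (mem_boxSet_iff.2 fun l => sub_mem_shiftBox hy₀ l)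
    have hy₀' := DNode.start_mem hC hR y₀
    refine ⟨?_, fun y hy0 hy => ?_⟩
    · obtain ⟨y, hy0, hy⟩ := ((I.withEDStages d).soundS hc hr₀ hy₀').1
      exact ⟨y, hy0, by rw [hT']; exact hy⟩
    · rw [hT'] at hy ⊢
      exact boxSet_mono (castBox_mono (le_of_boxLE hF))
        (EDChainCert.mem_finalHullS hc hr₀ hy₀' hy0 hy)

end VerifierPackaging

/-! ### The pendulum from a box, re-decided by the fast checker -/

section PendulumBoxDoubletonFast

/-- The fast verifier accepts the tree's eight-stage pendulum-from-a-box transcript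
`pendulumBoxDData` (cfg `⟨40, 30, 12, 3, 0⟩`), hence the instance's claim: every solution of the
pendulum from `W₀ = [0.99, 1.01] × [−0.01, 0.01]` exists on `[0, 1]` and has `y(1)` in the claimed
box — the same theorem as `pendulumBoxD_claim`, by the other checker.
[cite: KapelaZgliczynski2009, §6.1 and §6.4 (Evaluation 4)] [cite: Moore1979, §8.2 (the wrapping effect)] -/
theorem pendulumBoxDS_claim : pendulumBoxDInstance.Claim :=
  (eDoubletonChainVerifierS 2).sound (c := pendulumBoxDData) (by decide +kernel)

end PendulumBoxDoubletonFast

end Literature.Analysis.ODE
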